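import Literature.Algebra.Homology.FiniteCyclicH2CarryCocycle
import HarnessLib

/-!
# Functoriality of the carry classes `[c_σ · a] ∈ H²(G, A)` of a finite cyclic group: change of module
# and change of (cyclic) group along a homomorphism matching the generators
# (Serre, *Local Fields* VIII §4 Remark: `a ↦ a · θ_s` "clearly depends on the choice of `s`")

Topic `Algebra/Homology`; namespace `Literature.Algebra.Homology.FiniteCyclic` (sequel to
`FiniteCyclicH2CarryCocycle`: `carryClassHom σ _ A : A^G → H²(G, A)`, `a ↦ [c_σ · a]`, and to
`UnramifiedClassModule`: `Unramified.exponent`, `Unramified.carry`, `Unramified.frobeniusCocycle`).  Theorems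
only (no definition, no named fact, no instance, no notation, no `sorry`).

For a finite group `G` generated by `σ`, a `G`-module `A` and an invariant `a ∈ A^G`, the carry cocycle
`c_σ · a : (g, h) ↦ c_σ(g, h) a` (`c_σ(σⁱ, σʲ) = [i + j ≥ |G|]`, `0 ≤ i, j < |G|`) represents `a · θ_σ = a ∪ δχ_σ`
(Serre VIII §4).  This file records how these cocycles and classes move:

* §1 along a morphism of `G`-modules `f : A ⟶ B` (same group): `Z²(id, f)(c_σ · a) = c_σ · f(a)`
  (`mapCocycles₂_id_frobeniusCocycle`) and **`map_id_carryClassHom`**: `H²(id, f)[c_σ · a] = [c_σ · f(a)]`;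
* §2 along a group homomorphism `e : H → G` that carries a generator `τ` of `H` to `σ` with `|H| = |G|` (so `e`
  is an isomorphism of cyclic groups and `ι_σ(e h) = ι_τ(h)`, `exponent_comp_eq`): `Z²(e, φ)(c_σ · a) = c_τ · φ(a)`
  (`mapCocycles₂_frobeniusCocycle_of_apply_eq`) and **`map_carryClassHom_of_apply_eq`**:
  `H²(e, φ)[c_σ · a] = [c_τ · φ(a)]` — used with `e` the inclusion of a full decomposition group, the
  identification `G_w ≃ Gal(E_w/F_v)` of a completed layer, and the transport `Gal(E/K) ≃ Gal(E₀/K)` along a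
  `K`-isomorphism `E ≃ E₀` (Route A of the bsd-schneider cell: the local component of an idèle carry class).

## References
* J.-P. Serre, *Local Fields*, GTM 67 (1979), VIII §4 (Remark after the Corollary to Prop. 6). [Serre1979]
* J. Neukirch, *Class Field Theory — The Bonn Lectures* (2013), II §4 (proof of (4.5): exponents and carries).
  [Neukirch2013]
-/

noncomputable section

open CategoryTheory CategoryTheory.Limits groupCohomology

universe u

namespace Literature.Algebra.Homology

namespace FiniteCyclic

open Unramified

variable {k G : Type u} [CommRing k] [Group G] [Fintype G] (σ : G) (hσ : ∀ x, x ∈ Subgroup.zpowers σ)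

/-! ## §1 Change of module (same group) -/

section SameGroup

variable {A B : Rep.{u} k G} (f : A ⟶ B)

omit [Fintype G] in
/-- The image of an invariant under a morphism of `G`-modules is invariant (the invariants functor `A ↦ A^G`).
[cite: Brown1982CohomologyGroups, III §1 (the functor of invariants)] -/
theorem apply_mem_invariants_of_forall (a : A.V) (ha : ∀ g, A.ρ g a = a) (g : G) :
    B.ρ g (f.hom a) = f.hom a := by
  rw [← Rep.hom_comm_apply f g a, ha g]

/-- **`Z²(id, f)(c_σ · a) = c_σ · f(a)`** (cocycle level). [cite: Serre1979, VIII §4 (Remark)] -/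
theorem mapCocycles₂_id_frobeniusCocycle (a : A.V) (ha : ∀ g, A.ρ g a = a) :
    mapCocycles₂ (MonoidHom.id G) f (frobeniusCocycle σ hσ A a ha) =
      frobeniusCocycle σ hσ B (f.hom a) (apply_mem_invariants_of_forall f a ha) :=
  cocycles₂_ext fun g h => by
    rw [frobeniusCocycle_apply]
    change f.hom ((frobeniusCocycle σ hσ A a ha : G × G → A.V) (g, h)) = _
    rw [frobeniusCocycle_apply, map_smul]

/-- **`H²(id, f)[c_σ · a] = [c_σ · f(a)]`**: the carry-class map is natural in the module.
[cite: Serre1979, VIII §4 (Remark)] -/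
theorem map_id_H2π_frobeniusCocycle (a : A.V) (ha : ∀ g, A.ρ g a = a) :
    map (MonoidHom.id G) f 2 (H2π A (frobeniusCocycle σ hσ A a ha)) =
      H2π B (frobeniusCocycle σ hσ B (f.hom a) (apply_mem_invariants_of_forall f a ha)) := by
  rw [H2π_comp_map_apply, mapCocycles₂_id_frobeniusCocycle σ hσ f a ha]

omit [Fintype G] in
/-- The invariant vector `f(a) ∈ B^G` of `a ∈ A^G` (functoriality of invariants).
[cite: Brown1982CohomologyGroups, III §1 (the functor of invariants)] -/
theorem coe_mem_invariants_map (a : A.ρ.invariants) : f.hom (a : A.V) ∈ B.ρ.invariants :=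
  fun g => apply_mem_invariants_of_forall f a a.2 g

/-- **`H²(id, f) ∘ carryClassHom_A = carryClassHom_B ∘ f`** on `A^G`. [cite: Serre1979, VIII §4 (Remark)] -/
theorem map_id_carryClassHom (a : A.ρ.invariants) :
    map (MonoidHom.id G) f 2 (carryClassHom σ hσ A a) =
      carryClassHom σ hσ B ⟨f.hom (a : A.V), coe_mem_invariants_map f a⟩ := by
  rw [carryClassHom_apply, carryClassHom_apply, map_id_H2π_frobeniusCocycle σ hσ f]

end SameGroup

/-! ## §2 Change of group along a homomorphism matching the generators -/

section ChangeGroup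

variable {H : Type u} [Group H] [Fintype H] (τ : H) (hτ : ∀ x, x ∈ Subgroup.zpowers τ)
variable (e : H →* G) (he : e τ = σ) (hcard : Fintype.card H = Fintype.card G)

include he hcard in
/-- **`ι_σ(e h) = ι_τ(h)`**: a homomorphism of finite cyclic groups of the same order carrying the generator
`τ` to the generator `σ` preserves exponents. [cite: Neukirch2013, II §4 (proof of (4.5))] -/
theorem exponent_comp_eq (h : H) : exponent σ hσ (e h) = exponent τ hτ h := by
  conv_lhs => rw [← pow_exponent τ hτ h, map_pow, he, exponent_pow, ← hcard]
  exact Nat.mod_eq_of_lt (exponent_lt_card τ hτ h)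

include he hcard in
/-- **`c_σ(e h, e h') = c_τ(h, h')`** under the same hypotheses. [cite: Neukirch2013, II §4 (proof of (4.5))] -/
theorem carry_comp_eq (h h' : H) : carry σ hσ (e h) (e h') = carry τ hτ h h' := by
  rw [carry, carry, exponent_comp_eq σ hσ τ hτ e he hcard, exponent_comp_eq σ hσ τ hτ e he hcard, hcard]

variable {A : Rep.{u} k G} {B : Rep.{u} k H} (φ : Rep.res e A ⟶ B)

omit [Fintype G] [Fintype H] in
/-- The image under `φ : Res_e A ⟶ B` of a `G`-invariant is `H`-invariant (invariants along a compatible pair).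
[cite: Brown1982CohomologyGroups, III §8 (functoriality of cohomology in the pair `(G, M)`)] -/
theorem apply_mem_invariants_of_forall_res (a : A.V) (ha : ∀ g, A.ρ g a = a) (h : H) :
    B.ρ h (φ.hom a) = φ.hom a := by
  rw [← Rep.hom_comm_apply φ h a]
  exact congrArg φ.hom (ha (e h))

include he hcard in
/-- **`Z²(e, φ)(c_σ · a) = c_τ · φ(a)`** (cocycle level) when `e τ = σ` and `|H| = |G|`.
[cite: Serre1979, VIII §4 (Remark)][cite: Neukirch2013, II §4 (proof of (4.5))] -/
theorem mapCocycles₂_frobeniusCocycle_of_apply_eq (a : A.V) (ha : ∀ g, A.ρ g a = a) :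
    mapCocycles₂ e φ (frobeniusCocycle σ hσ A a ha) =
      frobeniusCocycle τ hτ B (φ.hom a) (apply_mem_invariants_of_forall_res e φ a ha) :=
  cocycles₂_ext fun h h' => by
    rw [frobeniusCocycle_apply]
    change φ.hom ((frobeniusCocycle σ hσ A a ha : G × G → A.V) (e h, e h')) = _
    rw [frobeniusCocycle_apply, map_smul, carry_comp_eq σ hσ τ hτ e he hcard]

include he hcard in
/-- **`H²(e, φ)[c_σ · a] = [c_τ · φ(a)]`** when `e τ = σ` and `|H| = |G|`.
[cite: Serre1979, VIII §4 (Remark)][cite: Neukirch2013, II §4 (proof of (4.5))] -/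
theorem map_H2π_frobeniusCocycle_of_apply_eq (a : A.V) (ha : ∀ g, A.ρ g a = a) :
    map e φ 2 (H2π A (frobeniusCocycle σ hσ A a ha)) =
      H2π B (frobeniusCocycle τ hτ B (φ.hom a) (apply_mem_invariants_of_forall_res e φ a ha)) := by
  rw [H2π_comp_map_apply, mapCocycles₂_frobeniusCocycle_of_apply_eq σ hσ τ hτ e he hcard φ a ha]

omit [Fintype G] [Fintype H] in
/-- The invariant vector `φ(a) ∈ B^H` of `a ∈ A^G` (invariants along a compatible pair).
[cite: Brown1982CohomologyGroups, III §8 (functoriality of cohomology in the pair `(G, M)`)] -/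
theorem coe_mem_invariants_map_res (a : A.ρ.invariants) : φ.hom (a : A.V) ∈ B.ρ.invariants :=
  fun h => apply_mem_invariants_of_forall_res e φ a a.2 h

include he hcard in
/-- **`H²(e, φ) ∘ carryClassHom_σ = carryClassHom_τ ∘ φ`** on `A^G`, when `e τ = σ` and `|H| = |G|`.
[cite: Serre1979, VIII §4 (Remark)][cite: Neukirch2013, II §4 (proof of (4.5))] -/
theorem map_carryClassHom_of_apply_eq (a : A.ρ.invariants) :
    map e φ 2 (carryClassHom σ hσ A a) =
      carryClassHom τ hτ B ⟨φ.hom (a : A.V), coe_mem_invariants_map_res e φ a⟩ := by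
  rw [carryClassHom_apply, carryClassHom_apply, map_H2π_frobeniusCocycle_of_apply_eq σ hσ τ hτ e he hcard φ]

end ChangeGroup

end FiniteCyclic

end Literature.Algebra.Homology

end
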